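import Summits.Ventures.HSemireg.ObstructionLocusBlockDevissageExt

/-!
# Venture HSemireg — (S5) OBSTRUCTION LOCUS away from secant type, XXIX: EXT-NOTE §6.B(b)
# «`𝓔xt¹(I, I) = 𝓝′`» for EVERY block model — crossing germs included — WITHOUT a Künneth formula

HONEST FRAMING.  Part of the Lean side of the computation cell `pub-hsemireg` (track «S4-PUSH» (ii), seat
s4-prove-2; files XXVII–XXIX, the whole argument is summarised in the module docstring of file XXVII
`ObstructionLocusBlockDevissage`).  Plain commutative / homological algebra in `R = MvPolynomial (Fin n) K`,
every `n`, EVERY commutative ring `K`, with Mathlib's derived `CategoryTheory.Abelian.Ext` in `ModuleCat R`.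
Nothing here constructs a variety or a sheaf; nothing here says that HC / HC_CM / HC_AV holds; no Literature fact
is declared or used; no object is certified.  (S5)'s status word («MODEL-LEVEL theorems modulo the named shapes
(H-arr), (H-NC)») is unchanged; what moves is the bracket: EXT-NOTE §6.B(b) is now a kernel theorem at EVERY point
of every (GEN) arrangement (file XXIV's `Blocks.ofPoint`), not only at single-translate germs; §6.A's
`pd_R I_M = r` at crossing germs is the sibling file XXX `ObstructionLocusBlockProjDim` (same dévissage) — of the
point-local dictionary of (H-arr) only §6.B(c)'s description of the higher `𝓔xt^q(I, I)`, `2 ≤ q ≤ r`, at crossing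
germs (tensor product of the block resolutions) stays prose, together with (H-arr)'s global half (étale chart,
sheafification, Prop. K, Čech line, completion, (R4)) and (H-NC).

* **`ext_comp_subtype_eq_zero_inf`** — THE INDUCTION STEP (STEPS 1–4 of file XXVII's docstring) for `U = I_S` and
  an ideal `V` with (V1)–(V4), `I_S ∩ V ⊆ I_S·V` and `ι_{V*} = 0`: then `ι_* = 0` on `Ext¹_R(I_S ∩ V, I_S ∩ V)`;
* `ext_comp_subtype_eq_zero_of_card` (induction on the number of blocks, peeling `S_{i₀}`; base `I_∅ = R`),
  **`ext_comp_subtype_eq_zero_arrIdeal`: `ι_* : Ext¹_R(I_M, I_M) → Ext¹_R(I_M, R)` IS ZERO for EVERY block model**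
  `M(S_1, …, S_r)` of file XVI — any `r`, free coordinates allowed, every `n`, every commutative `K`;
* **`delta_surjective_blocks`, `deltaEquivBlocks K B : Hom_R(I_M, R/I_M) ≃ₗ[R] Ext¹_R(I_M, I_M)`** (with file XXV's
  `BlockModel.delta_injective`) — EXT-NOTE §6.B(b) «`𝓔xt¹(I, I) = 𝓝′` via the connecting map `δ`» for every block
  model; **`extOneEquivBlocks K B : Ext¹_R(I_M, I_M) ≃ₗ[R] BranchFunctions K B = Π_{(i,a,b)} R/(x_b, x_a)`** (∘ file XIX's
  `blockNormalModuleEquiv`: «`𝓝′ = ⊕_B ν_{B*} N_{B/X}`, no poles, no gluing»); `embeddedDeformationEquivExtBlocks`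
  (∘ file `EmbeddedFirstOrderDeformations`, Hartshorne Prop. 2.3): the embedded first-order deformations of
  `M ⊂ 𝔸ⁿ` in `𝔸ⁿ × Spec K[ε]` ≃ `Ext¹_R(I_M, I_M)`, the trivial one ↦ `0`.
References (dictionary only): EXT-NOTE.md §6.0, §6.A, §6.B(b) (there: Künneth + the graded count of file XXIII);
G2-REDUCIBLE-POINT-THEOREM.md §2 L1 (ii).  Nearest prior art IN PRINT for the two sides of `δ`: Hartshorne,
Deformation Theory (GTM 257), Prop. 2.3 and Thm. 2.7 (as in file XXV); the dévissage is standard homological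
algebra, not taken from a source.
-/

open CategoryTheory CategoryTheory.Abelian MvPolynomial Finset
open scoped BigOperators

universe u

namespace Summit.Ventures.HSemireg.ObstructionLocus.BlockModel

variable {K : Type u} [CommRing K] {n : ℕ}

/-! ## The induction step: `ι_{V*} = 0 ⟹ ι_{(I_S ∩ V)*} = 0` -/

/-- **THE INDUCTION STEP of the dévissage.**  Let `U = I_S` (`a₀ ∈ S`) and let `V` be an ideal such that
(V2) every `x_a`, `a ∈ S`, is a non-zero-divisor modulo `V`; `I_S ∩ V ⊆ I_S · V`; (V1) `Hom_R(V, R) = R·ι`;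
(V3) `(I_S : V) = I_S`; (V4) `Hom_R(V, R/I_S) = (R/I_S)·π̄`; and (IH) `ι_{V*} = 0` on `Ext¹_R(V, V)`.  Then
`ι_* = 0` on `Ext¹_R(I_S ∩ V, I_S ∩ V)`.  Proof (file XXVII's module docstring, STEPS 1–4): with the dévissage
`0 → V^{S∖a₀} →Φ V^S →E I_S ∩ V → 0`, `E^*(ι_*ξ) = 0` by (IH); so `ι_*ξ = ∂θ`, `θ : V^{S∖a₀} → R`; reducing
modulo `U` (`p_U ι_* = 0`) and using (V1), (V4), (V3), `θ = ψ₀ ∘ Φ + Σ_b u_b · pr_b` with `u_b ∈ U`; and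
`u_b · pr_b ∈ im Φ^*` by the case `V = R` (`I_S · Ext¹_R(I_S, R) = 0`); hence `∂θ = 0`. -/
theorem ext_comp_subtype_eq_zero_inf (S : Finset (Fin n)) {a₀ : Fin n} (ha₀ : a₀ ∈ S)
    (V : Ideal (MvPolynomial (Fin n) K))
    (hV : ∀ a ∈ S, ∀ s : MvPolynomial (Fin n) K, X a * s ∈ V → s ∈ V)
    (hUV : blockIdeal K S ⊓ V ≤ blockIdeal K S * V)
    (hV1 : ∀ φ : ↥V →ₗ[MvPolynomial (Fin n) K] MvPolynomial (Fin n) K,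
      ∃ r : MvPolynomial (Fin n) K, ∀ v : ↥V, φ v = r * v.1)
    (hV3 : ∀ d : MvPolynomial (Fin n) K, (∀ v ∈ V, d * v ∈ blockIdeal K S) → d ∈ blockIdeal K S)
    (hV4 : ∀ ψ : ↥V →ₗ[MvPolynomial (Fin n) K] MvPolynomial (Fin n) K ⧸ blockIdeal K S,
      ∃ r : MvPolynomial (Fin n) K, ∀ v : ↥V, ψ v = Ideal.Quotient.mk (blockIdeal K S) (r * v.1))
    (hP : ∀ e : Ext.{u} (ModuleCat.of (MvPolynomial (Fin n) K) ↥V) (ModuleCat.of (MvPolynomial (Fin n) K) ↥V) 1,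
      e.comp (Ext.mk₀ (ModuleCat.ofHom V.subtype)) (add_zero 1) = 0)
    (ξ : Ext.{u} (ModuleCat.of (MvPolynomial (Fin n) K) ↥(blockIdeal K S ⊓ V))
      (ModuleCat.of (MvPolynomial (Fin n) K) ↥(blockIdeal K S ⊓ V)) 1) :
    ξ.comp (Ext.mk₀ (ModuleCat.ofHom (blockIdeal K S ⊓ V).subtype)) (add_zero 1) = 0 := by
  classical
  have hT := devissage_shortExact S V ha₀ hV hUV
  set η := ξ.comp (Ext.mk₀ (ModuleCat.ofHom ((blockIdeal K S) ⊓ V).subtype)) (add_zero 1) with hη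
  -- STEP 1: `E^*(ι_* ξ) = 0` in `Ext¹(V^S, R)`, by (IH) on the components
  have hE : (Ext.mk₀ (devissage S V ha₀).g).comp η (zero_add 1) = 0 := by
    have hfac : ModuleCat.ofHom ((blockIdeal K S) ⊓ V).subtype =
        ModuleCat.ofHom (Submodule.inclusion (inf_le_right : (blockIdeal K S) ⊓ V ≤ V)) ≫ ModuleCat.ofHom V.subtype := by
      apply ModuleCat.hom_ext; apply LinearMap.ext; intro x; rfl
    rw [hη, hfac, ← Ext.mk₀_comp_mk₀]
    simp only [← Ext.comp_assoc_of_third_deg_zero]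
    exact pi_ext_comp_subtype_eq_zero hP S _
  -- STEP 2: `ι_* ξ = ∂ θ` for some `θ : V^{S∖a₀} → R`
  obtain ⟨x₁, hx₁⟩ := Ext.contravariant_sequence_exact₃ hT
    (ModuleCat.of (MvPolynomial (Fin n) K) (MvPolynomial (Fin n) K)) η hE (show 1 + 0 = 1 by rfl)
  obtain ⟨θ, rfl⟩ := (Ext.mk₀_bijective _ _).2 x₁
  -- STEP 3: reduce modulo `(blockIdeal K S)`: `p_U (ι_* ξ) = 0`, so `π_U ∘ θ = ψ ∘ Φ_V`
  have hpU : η.comp (Ext.mk₀ (ModuleCat.ofHom (blockIdeal K S).mkQ)) (add_zero 1) = 0 := by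
    have h0 : ModuleCat.ofHom ((blockIdeal K S) ⊓ V).subtype ≫ ModuleCat.ofHom (blockIdeal K S).mkQ = 0 := by
      apply ModuleCat.hom_ext
      apply LinearMap.ext
      intro v
      rw [ModuleCat.hom_comp, ModuleCat.hom_ofHom, ModuleCat.hom_ofHom, LinearMap.comp_apply,
        Submodule.subtype_apply, Submodule.mkQ_apply, ModuleCat.hom_zero, LinearMap.zero_apply,
        Submodule.Quotient.mk_eq_zero]
      exact (Ideal.mem_inf.1 v.2).1
    rw [hη, Ext.comp_assoc_of_third_deg_zero, Ext.mk₀_comp_mk₀, h0, Ext.mk₀_zero, Ext.comp_zero]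
  have hθU : hT.extClass.comp (Ext.mk₀ (θ ≫ ModuleCat.ofHom (blockIdeal K S).mkQ)) (show 1 + 0 = 1 by rfl) = 0 := by
    rw [← Ext.mk₀_comp_mk₀, ← Ext.comp_assoc_of_third_deg_zero, hx₁, hpU]
  obtain ⟨x₂, hx₂⟩ := Ext.contravariant_sequence_exact₁ hT
    (ModuleCat.of (MvPolynomial (Fin n) K) (MvPolynomial (Fin n) K ⧸ (blockIdeal K S))) _ (show 1 + 0 = 1 by rfl) hθU
  obtain ⟨ψ, rfl⟩ := (Ext.mk₀_bijective _ _).2 x₂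
  rw [Ext.mk₀_comp_mk₀] at hx₂
  have hψ : ψ.hom ∘ₗ hbMap S a₀ V = (blockIdeal K S).mkQ ∘ₗ θ.hom := by
    have h := congr_arg ModuleCat.Hom.hom ((Ext.mk₀_bijective _ _).1 hx₂)
    rw [ModuleCat.hom_comp, ModuleCat.hom_comp] at h
    exact h
  -- STEP 4: the coefficients of `θ` (V1) and `ψ` (V4); `u_b ∈ (blockIdeal K S)` (V3)
  choose t ht using fun b : ↥(S.erase a₀) =>
    hV1 (θ.hom ∘ₗ LinearMap.single (MvPolynomial (Fin n) K) (fun _ : ↥(S.erase a₀) => ↥V) b)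
  choose c hc using fun a : ↥S =>
    hV4 (ψ.hom ∘ₗ LinearMap.single (MvPolynomial (Fin n) K) (fun _ : ↥S => ↥V) a)
  set u : ↥(S.erase a₀) → MvPolynomial (Fin n) K :=
    fun b => t b - c ⟨b.1, Finset.mem_of_mem_erase b.2⟩ * X b.1 + c ⟨a₀, ha₀⟩ * X a₀ with hu_def
  have ht' : ∀ (b : ↥(S.erase a₀)) (v : ↥V), θ.hom (Pi.single b v) = t b * v.1 := by
    intro b v
    have h := ht b v
    rwa [LinearMap.comp_apply, LinearMap.coe_single] at h
  have hc' : ∀ (a : ↥S) (v : ↥V), ψ.hom (Pi.single a v) = Ideal.Quotient.mk (blockIdeal K S) (c a * v.1) := by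
    intro a v
    have h := hc a v
    rwa [LinearMap.comp_apply, LinearMap.coe_single] at h
  have hu : ∀ b : ↥(S.erase a₀), u b ∈ (blockIdeal K S) := by
    intro b
    apply hV3
    intro v hv
    have key := LinearMap.congr_fun hψ (Pi.single b ⟨v, hv⟩)
    rw [LinearMap.comp_apply, LinearMap.comp_apply, hbMap_single S ha₀ V b ⟨v, hv⟩, map_sub, hc', hc', ht',
      Submodule.mkQ_apply, Ideal.Quotient.mk_eq_mk] at key
    simp only [Submodule.coe_smul, smul_eq_mul] at key
    rw [← Ideal.Quotient.eq_zero_iff_mem, hu_def]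
    have : (t b - c ⟨b.1, Finset.mem_of_mem_erase b.2⟩ * X b.1 + c ⟨a₀, ha₀⟩ * X a₀) * v
        = t b * v - c ⟨b.1, Finset.mem_of_mem_erase b.2⟩ * (X b.1 * v) + c ⟨a₀, ha₀⟩ * (X a₀ * v) := by ring
    rw [this, map_add, map_sub, ← key]
    ring
  -- STEP 4': `u_b · pr_b ∈ im Φ^*` (the dévissage with `V = R`)
  choose Ψ hΨ using fun b : ↥(S.erase a₀) => exists_comp_hbMap_eq_smul_proj S ha₀ (hu b) b
  -- the lift `Θ : V^S → R` of `θ` through `Φ_V`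
  set κ₂ : (↥S → ↥V) →ₗ[MvPolynomial (Fin n) K] (↥S → ↥(⊤ : Ideal (MvPolynomial (Fin n) K))) :=
    (Submodule.inclusion (le_top : V ≤ ⊤)).compLeft ↥S with hκ₂
  set Θ : (↥S → ↥V) →ₗ[MvPolynomial (Fin n) K] MvPolynomial (Fin n) K :=
    (∑ a : ↥S, c a • (V.subtype ∘ₗ LinearMap.proj a)) + ∑ b : ↥(S.erase a₀), Ψ b ∘ₗ κ₂ with hΘ_def
  have hΘ : θ.hom = Θ ∘ₗ hbMap S a₀ V := by
    apply LinearMap.pi_ext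
    intro b v
    have hnat : κ₂ (hbMap S a₀ V (Pi.single b v))
        = hbMap S a₀ ⊤ (Pi.single b (Submodule.inclusion (le_top : V ≤ ⊤) v)) := by
      rw [hκ₂, ← compLeft_inclusion_single, hbMap_compLeft_inclusion]
    have part2 : ∀ b' : ↥(S.erase a₀), (Ψ b' ∘ₗ κ₂) (hbMap S a₀ V (Pi.single b v))
        = u b' * ((Pi.single b (Submodule.inclusion (le_top : V ≤ ⊤) v) :
            ↥(S.erase a₀) → ↥(⊤ : Ideal (MvPolynomial (Fin n) K))) b' : MvPolynomial (Fin n) K) := by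
      intro b'
      rw [LinearMap.comp_apply, hnat, ← LinearMap.comp_apply (f := Ψ b'), hΨ b']
      rfl
    have hsum2 : (∑ b' : ↥(S.erase a₀), Ψ b' ∘ₗ κ₂) (hbMap S a₀ V (Pi.single b v)) = u b * v.1 := by
      rw [LinearMap.sum_apply, Finset.sum_congr rfl fun b' _ => part2 b', Finset.sum_eq_single b,
        Pi.single_eq_same, Submodule.coe_inclusion]
      · intro b' _ hb'
        rw [Pi.single_eq_of_ne hb', Submodule.coe_zero, mul_zero]
      · intro h
        exact absurd (Finset.mem_univ b) h
    have hsum1 : (∑ a : ↥S, c a • (V.subtype ∘ₗ LinearMap.proj a)) (hbMap S a₀ V (Pi.single b v))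
        = c ⟨b.1, Finset.mem_of_mem_erase b.2⟩ * (X b.1 * v.1) - c ⟨a₀, ha₀⟩ * (X a₀ * v.1) := by
      rw [hbMap_single S ha₀ V b v, map_sub, sum_smul_proj_single, sum_smul_proj_single]
      simp only [Submodule.coe_smul, smul_eq_mul]
    rw [ht', LinearMap.comp_apply, hΘ_def, LinearMap.add_apply, hsum1, hsum2, hu_def]
    ring
  -- conclusion: `θ` factors through `Φ_V`, so `∂ θ = 0`
  have hθ' : θ = (devissage S V ha₀).f ≫ ModuleCat.ofHom Θ := by
    apply ModuleCat.hom_ext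
    rw [ModuleCat.hom_comp]
    exact hΘ
  rw [← hx₁, hθ', ← Ext.mk₀_comp_mk₀]
  exact hT.extClass_comp_assoc _

/-! ## Every block model: induction on the number of blocks -/

/-- Transport of `ι_* = 0` along an equality of ideals. -/
theorem ext_comp_subtype_eq_zero_congr {J J' : Ideal (MvPolynomial (Fin n) K)} (h : J = J')
    (hJ : ∀ e : Ext.{u} (ModuleCat.of (MvPolynomial (Fin n) K) ↥J) (ModuleCat.of (MvPolynomial (Fin n) K) ↥J) 1,
      e.comp (Ext.mk₀ (ModuleCat.ofHom J.subtype)) (add_zero 1) = 0)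
    (e : Ext.{u} (ModuleCat.of (MvPolynomial (Fin n) K) ↥J') (ModuleCat.of (MvPolynomial (Fin n) K) ↥J') 1) :
    e.comp (Ext.mk₀ (ModuleCat.ofHom J'.subtype)) (add_zero 1) = 0 := by
  subst h; exact hJ e

/-- `ι_* = 0` for every block model with `k` blocks (induction on `k`; the step peels one block). -/
theorem ext_comp_subtype_eq_zero_of_card (k : ℕ) :
    ∀ {ι : Type*} [Fintype ι] (B : Blocks ι n), Fintype.card ι = k →
      ∀ e : Ext.{u} (ModuleCat.of (MvPolynomial (Fin n) K) ↥(arrIdeal K B))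
        (ModuleCat.of (MvPolynomial (Fin n) K) ↥(arrIdeal K B)) 1,
        e.comp (Ext.mk₀ (ModuleCat.ofHom (arrIdeal K B).subtype)) (add_zero 1) = 0 := by
  induction k with
  | zero =>
    intro ι _ B hk
    haveI : IsEmpty ι := Fintype.card_eq_zero_iff.1 hk
    exact ext_comp_subtype_eq_zero_congr (arrIdeal_eq_top_of_isEmpty B).symm ext_comp_subtype_eq_zero_top
  | succ k ih =>
    intro ι _ B hk
    classical
    obtain ⟨i₀⟩ : Nonempty ι := Fintype.card_pos_iff.1 (by omega)
    have hcard : Fintype.card {i // i ≠ i₀} = k := by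
      rw [Fintype.card_subtype, Finset.filter_ne', Finset.card_erase_of_mem (Finset.mem_univ _),
        Finset.card_univ, hk]
      rfl
    have hS := disjoint_allBlocks_restrict B i₀
    obtain ⟨a₀, ha₀⟩ := B.nonempty i₀
    have step := ext_comp_subtype_eq_zero_inf (B.S i₀) ha₀ (arrIdeal K (B.restrict (· ≠ i₀)))
      (X_mul_mem_arrIdeal_imp hS) (blockIdeal_inf_arrIdeal_restrict_le_mul B i₀)
      (exists_eq_mul_of_hom_to_ring _) (fun d hd => mem_blockIdeal_of_forall_mul_mem hS hd)
      (exists_eq_mk_mul_of_hom_to_quot _ hS) (ih _ hcard)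
    exact ext_comp_subtype_eq_zero_congr (arrIdeal_eq_blockIdeal_inf_restrict B i₀).symm step

variable {ι : Type*} [Fintype ι]

/-- **`ι_* : Ext¹_R(I_M, I_M) → Ext¹_R(I_M, R)` IS THE ZERO MAP for EVERY block model `M(S_1, …, S_r)`** — any
number `r` of blocks (crossing germs included), free coordinates allowed, every `n`, EVERY commutative ring `K`. -/
theorem ext_comp_subtype_eq_zero_arrIdeal (B : Blocks ι n)
    (e : Ext.{u} (ModuleCat.of (MvPolynomial (Fin n) K) ↥(arrIdeal K B))
      (ModuleCat.of (MvPolynomial (Fin n) K) ↥(arrIdeal K B)) 1) :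
    e.comp (Ext.mk₀ (ModuleCat.ofHom (arrIdeal K B).subtype)) (add_zero 1) = 0 :=
  ext_comp_subtype_eq_zero_of_card _ B rfl e

/-- **`δ : Hom_R(I_M, R/I_M) → Ext¹_R(I_M, I_M)` is SURJECTIVE for every block model** (every first-order
deformation of the module `I_M` comes from an embedded deformation of `M ⊂ 𝔸ⁿ`). -/
theorem delta_surjective_blocks (B : Blocks ι n) : Function.Surjective (delta (arrIdeal K B)) :=
  delta_surjective_of_ext_comp_subtype_eq_zero (ext_comp_subtype_eq_zero_arrIdeal B)

variable (K) in
/-- **EXT-NOTE §6.B(b) for EVERY block model over ANY commutative ring: the connecting homomorphism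
`δ : Hom_R(I_M, R/I_M) ≃ₗ[R] Ext¹_R(I_M, I_M)` of `0 → I_M → R → R/I_M → 0` is an `R`-linear ISOMORPHISM** —
injective by file XVI's `Hom_R(I_M, R) = R·ι` (file XXV's `BlockModel.delta_injective`), surjective by the
dévissage of files XXVII–XXIX.  At a CROSSING germ (`r ≥ 2` blocks, `pd_R I_M = r`) this is the statement the
paper reaches by Künneth + the graded count; here no Künneth formula, grading or localisation is used. -/
noncomputable def deltaEquivBlocks (B : Blocks ι n) :
    (↥(arrIdeal K B) →ₗ[MvPolynomial (Fin n) K] MvPolynomial (Fin n) K ⧸ arrIdeal K B)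
      ≃ₗ[MvPolynomial (Fin n) K]
        Ext.{u} (ModuleCat.of (MvPolynomial (Fin n) K) ↥(arrIdeal K B))
          (ModuleCat.of (MvPolynomial (Fin n) K) ↥(arrIdeal K B)) 1 :=
  LinearEquiv.ofBijective (delta (arrIdeal K B)) ⟨delta_injective B, delta_surjective_blocks B⟩

/-- `deltaEquivBlocks` is file XXV's `δ`. -/
theorem deltaEquivBlocks_apply (B : Blocks ι n)
    (φ : ↥(arrIdeal K B) →ₗ[MvPolynomial (Fin n) K] MvPolynomial (Fin n) K ⧸ arrIdeal K B) :
    deltaEquivBlocks K B φ = delta (arrIdeal K B) φ := rfl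

variable (K) in
/-- **`Ext¹_R(I_M, I_M) ≃ₗ[R] Π_{(i,a,b)} R/(x_b, x_a)` for EVERY block model over any commutative ring** —
Mathlib's derived `Ext¹` of the ideal of `M(S_1, …, S_r) = ⋃_i K_{S_i} × 𝔸` with itself IS file XIX's module of
branch functions: EXT-NOTE §6.B(b) «`𝓔xt¹(I_Z, I_Z) = 𝓝′ = ⊕_B ν_{B*} N_{B/X}`» at EVERY point of a (GEN)
arrangement `Z_T` (file XXIV's `Blocks.ofPoint`), crossing points of `m ≥ 2` translates included. -/
noncomputable def extOneEquivBlocks [DecidableEq ι] (B : Blocks ι n) :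
    Ext.{u} (ModuleCat.of (MvPolynomial (Fin n) K) ↥(arrIdeal K B))
        (ModuleCat.of (MvPolynomial (Fin n) K) ↥(arrIdeal K B)) 1
      ≃ₗ[MvPolynomial (Fin n) K] BranchFunctions K B :=
  (deltaEquivBlocks K B).symm ≪≫ₗ blockNormalModuleEquiv K B

variable (K) in
/-- **The embedded first-order deformations of a block model `M ⊂ 𝔸ⁿ` in `𝔸ⁿ × Spec K[ε]` correspond bijectively
to `Ext¹_R(I_M, I_M)`** (Hartshorne Prop. 2.3 — file `EmbeddedFirstOrderDeformations` — composed with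
`deltaEquivBlocks`), every block model, every `n`, every commutative `K`; the trivial deformation goes to `0`. -/
noncomputable def embeddedDeformationEquivExtBlocks (B : Blocks ι n) :
    {J : Ideal (DualNumber (MvPolynomial (Fin n) K)) // EmbeddedDeformation.IsEmbeddedDeformation (arrIdeal K B) J}
      ≃ Ext.{u} (ModuleCat.of (MvPolynomial (Fin n) K) ↥(arrIdeal K B))
          (ModuleCat.of (MvPolynomial (Fin n) K) ↥(arrIdeal K B)) 1 :=
  (EmbeddedDeformation.equiv (arrIdeal K B)).trans (deltaEquivBlocks K B).toEquiv

/-- The trivial embedded deformation `I_M · R[ε]` corresponds to `0`. -/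
theorem embeddedDeformationEquivExtBlocks_trivial (B : Blocks ι n) :
    embeddedDeformationEquivExtBlocks K B ⟨(arrIdeal K B).map (algebraMap _ (DualNumber (MvPolynomial (Fin n) K))),
      EmbeddedDeformation.isEmbeddedDeformation_map (arrIdeal K B)⟩ = 0 := by
  simp [embeddedDeformationEquivExtBlocks, EmbeddedDeformation.equiv, EmbeddedDeformation.normalVector_map,
    deltaEquivBlocks]

end Summit.Ventures.HSemireg.ObstructionLocus.BlockModel
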